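import Mathlib
import Summits.ValiantsHypothesis.ValiantsHypothesis.Theorems.KPlusLogSqLawTropicalBTwoSidedSeparable

/-!
# Route «KPlusLogSqLaw», crux `TropicalB` (stmt-ValiantsHypothesis-19771) — THE TWO-SIDED SEPARABLE SECTOR, part 4: THE ROWS
# `K = 3 ⇒ n ≤ 2m`, `K = 4 ⇒ n ≤ 4m`, dominant-digit exponents ⇒ `n ≤ m·(2^{K−1} − 1)` ⇒ the crux's inequality with `C = 1` on the sector

HONEST FRAMING.  Helper toward the registered stubs `stub_tropThin` / `stub_tropFat` of `Cruxes/TropicalB/Lines/birth.lean` (crux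
`Summit.ValiantsHypothesis.ValiantsHypothesis.Theses.KPlusLogSqLaw.TropicalB`, item stmt-ValiantsHypothesis-19771, route KPlusLogSqLaw;
cell `pub-symmetroid`, seat val-sym-trop-p1 g19, 2026-08-28; `--supports … --as helper`).  SECTOR rows: instances of the sector law
`TwoSided.chain_le_alt` (part 3, `…TropicalBTwoSidedSeparable`) obtained by exhibiting small sign-equivalent potentials.  Two-sided
separable designs with a fine tie-break (`d = M·e`, `v a b l = M(r a l + c b l) + w a b`, `0 ≤ w ≤ B`, `m·B < M`, full support) are a
dense in-window family, NOT general designs: nothing here bounds `TropicalB`, and nothing bears on `WeakLifting`, DoorA26 / DoorA34,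
`MatrixDescartes` (stmt-ValiantsHypothesis-18050) or VP ≠ VNP.

THE ROWS (every chain in the hypothesis list of `TropicalCensus.TropRootLawAt`: strictly increasing integer slopes, unique optima,
alternating signs; `n` = number of sign changes).
* `chain_le_spread` — `u = e`: `n ≤ m·(E₁ − E₀)` for `E₀ ≤ e ≤ E₁` (the tree's spread bound `n ≤ m·(max d − min d)`, …ThinRanges, divided by
  the coarse scale `M`).
* `signEquiv_three`, `chain_le_three` — **`K = 3`, `e 0 < e 1 < e 2`: `n ≤ 2m`** (`u = (0,1,2)`; balanced sign vectors in dimension 3 are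
  `±(eᵢ − eⱼ)`).  Located: the hub census of this seat finds `2m` ATTAINED for `m = 6, 7, 8` in the sector, against `C(m+2,2) − 1` for general
  `K = 3` designs (SHIFT-THREE, `tropRootLawAt_three_iff`): the sector's free permutation register does not multiply the class register.
* `signEquiv_four_convex/flat/concave`, `chain_le_four` — **`K = 4`, `e` strictly increasing: `n ≤ 4m`** (`u = (0,1,2,4)`, `(0,1,2,3)`,
  `(0,2,3,4)` according to the sign of `e 0 + e 3 − (e 1 + e 2)`).  Located: `21 @ m = 6`, `23 @ m = 6` (concave cell), `32 @ m = 10` found;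
  the counting-tight general cells `(3,4) = 19 > 12`, `(4,4) = 34 > 16` are therefore NOT two-sided separable.
* `signEquiv_domDigit`, `chain_le_domDigit` — **dominant digits (`Σ_{j<l} e j < e l` for all `l`): `n ≤ m·(2^{K−1} − 1)`** (`u l = 2^l`:
  the sign of `⟨e,z⟩` and of `⟨u,z⟩` is the sign of the top nonzero entry of `z`), and `tropKPlusLogSq_shape_domDigit`: **`n ≤
  2^(1·(K + ⌊log₂ m⌋²))`, the inequality of `TropicalB` with `C = 1`, for every format, on this part of the sector** — `log₂ m + K − 1` bits where
  slope counting gives `K·log₂(em/K)`.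
READING (located, not claimed).  The height of the smallest sign-equivalent integer vector is a SIGN-CELL invariant of `e` (threshold-type
arrangement of balanced `{−1,0,1}`-vectors); it is `2` at `K = 3`, `≤ 4` at `K = 4`, `≤ 2^{K−1}` on the lexicographic cells, and polynomial
weights cannot serve all cells for large `K` (anti-Hadamard phenomena) — so the sector law is linear in `m` at every fixed sign cell but its
`K`-dependence is cell-dependent.  [this file]
-/

set_option linter.dupNamespace false
set_option autoImplicit false

namespace Summit.ValiantsHypothesis.ValiantsHypothesis.Theorems.KPlusLogSqLaw

namespace TwoSided

open Summit.ValiantsHypothesis.ValiantsHypothesis.Theorems.MatrixDescartes.Negative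
open scoped BigOperators
open Finset

variable {m K : ℕ}

/-! ## 1. The spread row of the sector -/

/-- **Sector spread row**: `u = e` is trivially sign-equivalent, so `n ≤ m·(E₁ − E₀)` — the spread bound divided by the coarse scale.
[this file] -/
theorem chain_le_spread (e : Fin K → ℕ) (M : ℕ) (d : Fin K → ℕ) (hd : ∀ l, d l = M * e l)
    (r c : Fin m → Fin K → ℤ) (w : Fin m → Fin m → ℤ) (B : ℤ)
    (hw0 : ∀ a b, 0 ≤ w a b) (hwB : ∀ a b, w a b ≤ B) (hMB : (m : ℤ) * B < M)
    (v ε : Fin m → Fin m → Fin K → ℤ) (hv : ∀ a b l, v a b l = (M : ℤ) * (r a l + c b l) + w a b)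
    (hε : ∀ a b l, ε a b l ≠ 0) (E₀ E₁ : ℕ) (hE : ∀ l, E₀ ≤ e l ∧ e l ≤ E₁)
    {n : ℕ} (θ : Fin (n + 1) → ℤ) (p : Fin (n + 1) → Equiv.Perm (Fin m) × (Fin m → Fin K))
    (hθ : StrictMono θ) (hdom : ∀ k, IsDominant d v ε (θ k) (p k))
    (halt : ∀ k : Fin n, termSign ε (p k.castSucc) * termSign ε (p k.succ) < 0) :
    (n : ℤ) ≤ m * ((E₁ : ℤ) - E₀) :=
  chain_le_alt e M d hd r c w B hw0 hwB hMB v ε hv hε (fun l => (e l : ℤ)) (fun _ _ _ => ⟨id, id⟩) E₀ E₁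
    (fun l => ⟨by exact_mod_cast (hE l).1, by exact_mod_cast (hE l).2⟩) θ p hθ hdom halt

/-! ## 2. Three classes: `n ≤ 2m` -/

/-- the rank potential `(0,1,2)` is sign-equivalent to any strictly sorted `e : Fin 3 → ℕ` on balanced sign vectors. [this file] -/
theorem signEquiv_three (e : Fin 3 → ℕ) (h01 : e 0 < e 1) (h12 : e 1 < e 2) :
    ∀ z : Fin 3 → ℤ, (∀ l, z l = -1 ∨ z l = 0 ∨ z l = 1) → ∑ l, z l = 0 →
      (0 ≤ ∑ l, (e l : ℤ) * z l → 0 ≤ ∑ l : Fin 3, ((l : ℕ) : ℤ) * z l) ∧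
        (0 < ∑ l, (e l : ℤ) * z l → 0 < ∑ l : Fin 3, ((l : ℕ) : ℤ) * z l) := by
  intro z hz hs
  have h01' : (e 0 : ℤ) < e 1 := by exact_mod_cast h01
  have h12' : (e 1 : ℤ) < e 2 := by exact_mod_cast h12
  rcases hz 0 with h0 | h0 | h0 <;> rcases hz 1 with h1 | h1 | h1 <;> rcases hz 2 with h2 | h2 | h2 <;>
    simp only [Fin.sum_univ_three, h0, h1, h2] at hs <;> norm_num at hs <;>
    refine ⟨fun h => ?_, fun h => ?_⟩ <;> simp [Fin.sum_univ_three, h0, h1, h2] at h ⊢ <;> omega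

/-- **`K = 3` row of the sector: `n ≤ 2m`** (exponents `d = M·e` with `e 0 < e 1 < e 2`). [this file] -/
theorem chain_le_three (e : Fin 3 → ℕ) (h01 : e 0 < e 1) (h12 : e 1 < e 2) (M : ℕ) (d : Fin 3 → ℕ) (hd : ∀ l, d l = M * e l)
    (r c : Fin m → Fin 3 → ℤ) (w : Fin m → Fin m → ℤ) (B : ℤ)
    (hw0 : ∀ a b, 0 ≤ w a b) (hwB : ∀ a b, w a b ≤ B) (hMB : (m : ℤ) * B < M)
    (v ε : Fin m → Fin m → Fin 3 → ℤ) (hv : ∀ a b l, v a b l = (M : ℤ) * (r a l + c b l) + w a b)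
    (hε : ∀ a b l, ε a b l ≠ 0)
    {n : ℕ} (θ : Fin (n + 1) → ℤ) (p : Fin (n + 1) → Equiv.Perm (Fin m) × (Fin m → Fin 3))
    (hθ : StrictMono θ) (hdom : ∀ k, IsDominant d v ε (θ k) (p k))
    (halt : ∀ k : Fin n, termSign ε (p k.castSucc) * termSign ε (p k.succ) < 0) :
    n ≤ 2 * m := by
  have h := chain_le_alt e M d hd r c w B hw0 hwB hMB v ε hv hε (fun l => ((l : ℕ) : ℤ)) (signEquiv_three e h01 h12) 0 2
    (fun l => ⟨by positivity, by have := l.isLt; omega⟩) θ p hθ hdom halt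
  have : (n : ℤ) ≤ 2 * m := by linarith
  exact_mod_cast this


/-! ## 3. Four classes: `n ≤ 4m` -/

/-- convex cell `e 1 + e 2 < e 0 + e 3`: the potential `(0,1,2,4)` is sign-equivalent. [this file] -/
theorem signEquiv_four_convex (e : Fin 4 → ℕ) (h01 : e 0 < e 1) (h12 : e 1 < e 2) (h23 : e 2 < e 3)
    (hcx : e 1 + e 2 < e 0 + e 3) :
    ∀ z : Fin 4 → ℤ, (∀ l, z l = -1 ∨ z l = 0 ∨ z l = 1) → ∑ l, z l = 0 →
      (0 ≤ ∑ l, (e l : ℤ) * z l → 0 ≤ ∑ l, (![(0 : ℤ), 1, 2, 4] l) * z l) ∧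
        (0 < ∑ l, (e l : ℤ) * z l → 0 < ∑ l, (![(0 : ℤ), 1, 2, 4] l) * z l) := by
  intro z hz hs
  have h01' : (e 0 : ℤ) < e 1 := by exact_mod_cast h01
  have h12' : (e 1 : ℤ) < e 2 := by exact_mod_cast h12
  have h23' : (e 2 : ℤ) < e 3 := by exact_mod_cast h23
  have hcx' : (e 1 : ℤ) + e 2 < e 0 + e 3 := by exact_mod_cast hcx
  rcases hz 0 with h0 | h0 | h0 <;> rcases hz 1 with h1 | h1 | h1 <;> rcases hz 2 with h2 | h2 | h2 <;>
    rcases hz 3 with h3 | h3 | h3 <;> simp only [Fin.sum_univ_four, h0, h1, h2, h3] at hs <;> norm_num at hs <;>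
    refine ⟨fun h => ?_, fun h => ?_⟩ <;> simp [Fin.sum_univ_four, h0, h1, h2, h3] at h ⊢ <;> omega

/-- flat cell `e 0 + e 3 = e 1 + e 2`: the potential `(0,1,2,3)` is sign-equivalent. [this file] -/
theorem signEquiv_four_flat (e : Fin 4 → ℕ) (h01 : e 0 < e 1) (h12 : e 1 < e 2) (h23 : e 2 < e 3)
    (hfl : e 0 + e 3 = e 1 + e 2) :
    ∀ z : Fin 4 → ℤ, (∀ l, z l = -1 ∨ z l = 0 ∨ z l = 1) → ∑ l, z l = 0 →
      (0 ≤ ∑ l, (e l : ℤ) * z l → 0 ≤ ∑ l, (![(0 : ℤ), 1, 2, 3] l) * z l) ∧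
        (0 < ∑ l, (e l : ℤ) * z l → 0 < ∑ l, (![(0 : ℤ), 1, 2, 3] l) * z l) := by
  intro z hz hs
  have h01' : (e 0 : ℤ) < e 1 := by exact_mod_cast h01
  have h12' : (e 1 : ℤ) < e 2 := by exact_mod_cast h12
  have h23' : (e 2 : ℤ) < e 3 := by exact_mod_cast h23
  have hfl' : (e 0 : ℤ) + e 3 = e 1 + e 2 := by exact_mod_cast hfl
  rcases hz 0 with h0 | h0 | h0 <;> rcases hz 1 with h1 | h1 | h1 <;> rcases hz 2 with h2 | h2 | h2 <;>
    rcases hz 3 with h3 | h3 | h3 <;> simp only [Fin.sum_univ_four, h0, h1, h2, h3] at hs <;> norm_num at hs <;>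
    refine ⟨fun h => ?_, fun h => ?_⟩ <;> simp [Fin.sum_univ_four, h0, h1, h2, h3] at h ⊢ <;> omega

/-- concave cell `e 0 + e 3 < e 1 + e 2`: the potential `(0,2,3,4)` is sign-equivalent. [this file] -/
theorem signEquiv_four_concave (e : Fin 4 → ℕ) (h01 : e 0 < e 1) (h12 : e 1 < e 2) (h23 : e 2 < e 3)
    (hcv : e 0 + e 3 < e 1 + e 2) :
    ∀ z : Fin 4 → ℤ, (∀ l, z l = -1 ∨ z l = 0 ∨ z l = 1) → ∑ l, z l = 0 →
      (0 ≤ ∑ l, (e l : ℤ) * z l → 0 ≤ ∑ l, (![(0 : ℤ), 2, 3, 4] l) * z l) ∧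
        (0 < ∑ l, (e l : ℤ) * z l → 0 < ∑ l, (![(0 : ℤ), 2, 3, 4] l) * z l) := by
  intro z hz hs
  have h01' : (e 0 : ℤ) < e 1 := by exact_mod_cast h01
  have h12' : (e 1 : ℤ) < e 2 := by exact_mod_cast h12
  have h23' : (e 2 : ℤ) < e 3 := by exact_mod_cast h23
  have hcv' : (e 0 : ℤ) + e 3 < e 1 + e 2 := by exact_mod_cast hcv
  rcases hz 0 with h0 | h0 | h0 <;> rcases hz 1 with h1 | h1 | h1 <;> rcases hz 2 with h2 | h2 | h2 <;>
    rcases hz 3 with h3 | h3 | h3 <;> simp only [Fin.sum_univ_four, h0, h1, h2, h3] at hs <;> norm_num at hs <;>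
    refine ⟨fun h => ?_, fun h => ?_⟩ <;> simp [Fin.sum_univ_four, h0, h1, h2, h3] at h ⊢ <;> omega

/-- **`K = 4` row of the sector: `n ≤ 4m`** (exponents `d = M·e` with `e` strictly increasing; three sign cells, heights `4, 3, 4`).
[this file] -/
theorem chain_le_four (e : Fin 4 → ℕ) (h01 : e 0 < e 1) (h12 : e 1 < e 2) (h23 : e 2 < e 3)
    (M : ℕ) (d : Fin 4 → ℕ) (hd : ∀ l, d l = M * e l)
    (r c : Fin m → Fin 4 → ℤ) (w : Fin m → Fin m → ℤ) (B : ℤ)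
    (hw0 : ∀ a b, 0 ≤ w a b) (hwB : ∀ a b, w a b ≤ B) (hMB : (m : ℤ) * B < M)
    (v ε : Fin m → Fin m → Fin 4 → ℤ) (hv : ∀ a b l, v a b l = (M : ℤ) * (r a l + c b l) + w a b)
    (hε : ∀ a b l, ε a b l ≠ 0)
    {n : ℕ} (θ : Fin (n + 1) → ℤ) (p : Fin (n + 1) → Equiv.Perm (Fin m) × (Fin m → Fin 4))
    (hθ : StrictMono θ) (hdom : ∀ k, IsDominant d v ε (θ k) (p k))
    (halt : ∀ k : Fin n, termSign ε (p k.castSucc) * termSign ε (p k.succ) < 0) :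
    n ≤ 4 * m := by
  rcases lt_trichotomy (e 1 + e 2) (e 0 + e 3) with hc | hc | hc
  · have h := chain_le_alt e M d hd r c w B hw0 hwB hMB v ε hv hε _ (signEquiv_four_convex e h01 h12 h23 hc) 0 4
      (fun l => by fin_cases l <;> simp) θ p hθ hdom halt
    have : (n : ℤ) ≤ 4 * m := by linarith
    exact_mod_cast this
  · have h := chain_le_alt e M d hd r c w B hw0 hwB hMB v ε hv hε _ (signEquiv_four_flat e h01 h12 h23 hc.symm) 0 3
      (fun l => by fin_cases l <;> simp) θ p hθ hdom halt
    have : (n : ℤ) ≤ 4 * m := by nlinarith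
    exact_mod_cast this
  · have h := chain_le_alt e M d hd r c w B hw0 hwB hMB v ε hv hε _ (signEquiv_four_concave e h01 h12 h23 hc) 0 4
      (fun l => by fin_cases l <;> simp) θ p hθ hdom halt
    have : (n : ℤ) ≤ 4 * m := by linarith
    exact_mod_cast this

/-! ## 4. Dominant digits: `n ≤ m·(2^{K−1} − 1)`, the crux's inequality with `C = 1` -/

/-- `Σ_{l < K} 2^l = 2^K − 1`. [folklore] -/
theorem sum_two_pow_fin (K : ℕ) : ∑ l : Fin K, (2 : ℤ) ^ (l : ℕ) = 2 ^ K - 1 := by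
  induction K with
  | zero => simp
  | succ K ih =>
    rw [Fin.sum_univ_castSucc]
    simp only [Fin.val_castSucc, Fin.val_last]
    rw [ih]; ring

/-- **Dominant digits: the sign of `⟨e, z⟩` on sign vectors is the sign of `⟨2^·, z⟩`** (both are the top nonzero entry of `z`):
if `Σ_{j<l} e j < e l` for every `l`, then for every `z : Fin K → {−1,0,1}`, `⟨e,z⟩ > 0 ↔ ⟨2^·,z⟩ > 0` and `⟨e,z⟩ < 0 ↔ ⟨2^·,z⟩ < 0`.
[this file] -/
theorem domDigit_sign : ∀ (K : ℕ) (e : Fin K → ℕ), (∀ l : Fin K, (∑ j : Fin K, if j < l then (e j : ℤ) else 0) < e l) →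
    ∀ z : Fin K → ℤ, (∀ l, z l = -1 ∨ z l = 0 ∨ z l = 1) →
      ((0 < ∑ l, (e l : ℤ) * z l ↔ 0 < ∑ l : Fin K, (2 : ℤ) ^ (l : ℕ) * z l) ∧
        (∑ l, (e l : ℤ) * z l < 0 ↔ ∑ l : Fin K, (2 : ℤ) ^ (l : ℕ) * z l < 0)) := by
  intro K
  induction K with
  | zero => intro e _ z _; simp
  | succ K ih =>
    intro e he z hz
    -- restrict to the first `K` digits
    have he' : ∀ l : Fin K, (∑ j : Fin K, if j < l then ((e j.castSucc : ℕ) : ℤ) else 0) < e l.castSucc := by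
      intro l
      have h := he l.castSucc
      rw [Fin.sum_univ_castSucc] at h
      simp only [Fin.castSucc_lt_castSucc_iff, if_neg (lt_asymm (Fin.castSucc_lt_last l))] at h
      simpa using h
    have hA : (∑ j : Fin K, ((e j.castSucc : ℕ) : ℤ)) < e (Fin.last K) := by
      have h := he (Fin.last K)
      rw [Fin.sum_univ_castSucc] at h
      simp only [Fin.castSucc_lt_last, if_true, lt_irrefl, if_false, add_zero] at h
      exact h
    have hIH := ih (fun j => e j.castSucc) he' (fun j => z j.castSucc) (fun j => hz _)
    -- bounds on the restricted sums
    have hbe : |∑ j : Fin K, ((e j.castSucc : ℕ) : ℤ) * z j.castSucc| ≤ ∑ j : Fin K, ((e j.castSucc : ℕ) : ℤ) := by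
      refine (Finset.abs_sum_le_sum_abs _ _).trans (Finset.sum_le_sum fun j _ => ?_)
      rw [abs_mul, Nat.abs_cast]
      have : |z j.castSucc| ≤ 1 := by rcases hz j.castSucc with h | h | h <;> simp [h]
      nlinarith [Nat.cast_nonneg (α := ℤ) (e j.castSucc)]
    have hbu : |∑ j : Fin K, (2 : ℤ) ^ (j : ℕ) * z j.castSucc| ≤ 2 ^ K - 1 := by
      rw [← sum_two_pow_fin K]
      refine (Finset.abs_sum_le_sum_abs _ _).trans (Finset.sum_le_sum fun j _ => ?_)
      rw [abs_mul, abs_of_pos (by positivity : (0 : ℤ) < 2 ^ (j : ℕ))]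
      have : |z j.castSucc| ≤ 1 := by rcases hz j.castSucc with h | h | h <;> simp [h]
      nlinarith [(by positivity : (0 : ℤ) < 2 ^ (j : ℕ))]
    have hbe' := abs_le.mp hbe
    have hbu' := abs_le.mp hbu
    rw [Fin.sum_univ_castSucc, Fin.sum_univ_castSucc]
    simp only [Fin.val_castSucc, Fin.val_last]
    rcases hz (Fin.last K) with h | h | h <;> rw [h]
    · constructor
      · constructor <;> intro hh <;> linarith
      · constructor <;> intro _ <;> linarith
    · simp only [mul_zero, add_zero]
      simpa using hIH
    · constructor
      · constructor <;> intro _ <;> linarith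
      · constructor <;> intro hh <;> linarith

/-- sign-equivalence of the binary potential `2^l` with dominant-digit exponents, in the format of the sector law. [this file] -/
theorem signEquiv_domDigit (e : Fin K → ℕ) (hdd : ∀ l : Fin K, (∑ j : Fin K, if j < l then (e j : ℤ) else 0) < e l) :
    ∀ z : Fin K → ℤ, (∀ l, z l = -1 ∨ z l = 0 ∨ z l = 1) → ∑ l, z l = 0 →
      (0 ≤ ∑ l, (e l : ℤ) * z l → 0 ≤ ∑ l : Fin K, (2 : ℤ) ^ (l : ℕ) * z l) ∧
        (0 < ∑ l, (e l : ℤ) * z l → 0 < ∑ l : Fin K, (2 : ℤ) ^ (l : ℕ) * z l) := by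
  intro z hz _
  have h := domDigit_sign K e hdd z hz
  exact ⟨fun h0 => not_lt.mp fun hneg => absurd (h.2.mpr hneg) (not_lt.mpr h0), fun hpos => h.1.mp hpos⟩

/-- **Dominant-digit row of the sector: `n ≤ m·(2^{K−1} − 1)`** (`K − 1` bits of class register per row of potential, no more).
[this file] -/
theorem chain_le_domDigit (e : Fin K → ℕ) (hdd : ∀ l : Fin K, (∑ j : Fin K, if j < l then (e j : ℤ) else 0) < e l)
    (M : ℕ) (d : Fin K → ℕ) (hd : ∀ l, d l = M * e l)
    (r c : Fin m → Fin K → ℤ) (w : Fin m → Fin m → ℤ) (B : ℤ)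
    (hw0 : ∀ a b, 0 ≤ w a b) (hwB : ∀ a b, w a b ≤ B) (hMB : (m : ℤ) * B < M)
    (v ε : Fin m → Fin m → Fin K → ℤ) (hv : ∀ a b l, v a b l = (M : ℤ) * (r a l + c b l) + w a b)
    (hε : ∀ a b l, ε a b l ≠ 0)
    {n : ℕ} (θ : Fin (n + 1) → ℤ) (p : Fin (n + 1) → Equiv.Perm (Fin m) × (Fin m → Fin K))
    (hθ : StrictMono θ) (hdom : ∀ k, IsDominant d v ε (θ k) (p k))
    (halt : ∀ k : Fin n, termSign ε (p k.castSucc) * termSign ε (p k.succ) < 0) :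
    (n : ℤ) ≤ m * ((2 : ℤ) ^ (K - 1) - 1) :=
  chain_le_alt e M d hd r c w B hw0 hwB hMB v ε hv hε (fun l => (2 : ℤ) ^ (l : ℕ)) (signEquiv_domDigit e hdd) 1
    ((2 : ℤ) ^ (K - 1)) (fun l => ⟨one_le_pow₀ (by norm_num),
      pow_le_pow_right₀ (by norm_num) (by have := l.isLt; omega)⟩) θ p hθ hdom halt

/-- **The inequality of `TropicalB` with `C = 1` on the dominant-digit part of the sector**: every sign-alternating dominant chain of such
a design has `n ≤ 2^(1·(K + ⌊log₂ m⌋²))` — for EVERY format `(m, K)`.  (A sector statement: nothing is claimed for general designs.)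
[this file] -/
theorem tropKPlusLogSq_shape_domDigit (e : Fin K → ℕ)
    (hdd : ∀ l : Fin K, (∑ j : Fin K, if j < l then (e j : ℤ) else 0) < e l)
    (M : ℕ) (d : Fin K → ℕ) (hd : ∀ l, d l = M * e l)
    (r c : Fin m → Fin K → ℤ) (w : Fin m → Fin m → ℤ) (B : ℤ)
    (hw0 : ∀ a b, 0 ≤ w a b) (hwB : ∀ a b, w a b ≤ B) (hMB : (m : ℤ) * B < M)
    (v ε : Fin m → Fin m → Fin K → ℤ) (hv : ∀ a b l, v a b l = (M : ℤ) * (r a l + c b l) + w a b)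
    (hε : ∀ a b l, ε a b l ≠ 0)
    {n : ℕ} (θ : Fin (n + 1) → ℤ) (p : Fin (n + 1) → Equiv.Perm (Fin m) × (Fin m → Fin K))
    (hθ : StrictMono θ) (hdom : ∀ k, IsDominant d v ε (θ k) (p k))
    (halt : ∀ k : Fin n, termSign ε (p k.castSucc) * termSign ε (p k.succ) < 0) :
    n ≤ 2 ^ (1 * (K + Nat.log 2 m ^ 2)) := by
  have h := chain_le_domDigit e hdd M d hd r c w B hw0 hwB hMB v ε hv hε θ p hθ hdom halt
  rw [one_mul]
  rcases Nat.eq_zero_or_pos K with hK | hK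
  · -- no classes: the bound of `chain_le_domDigit` is `0`
    subst hK
    have : (n : ℤ) ≤ 0 := by simpa using h
    have hn : n = 0 := by omega
    simp [hn]
  -- `n ≤ m·2^(K−1) ≤ 2^(⌊log₂ m⌋ + 1)·2^(K−1) ≤ 2^(K + ⌊log₂ m⌋²)`
  have hm : (m : ℤ) < 2 ^ (Nat.log 2 m + 1) := by exact_mod_cast Nat.lt_pow_succ_log_self (by norm_num) m
  have hL : Nat.log 2 m ≤ Nat.log 2 m ^ 2 := Nat.le_self_pow two_ne_zero _
  have h1 : (n : ℤ) ≤ m * (2 : ℤ) ^ (K - 1) := by nlinarith [(by positivity : (0 : ℤ) ≤ m)]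
  have h2 : (m : ℤ) * (2 : ℤ) ^ (K - 1) ≤ 2 ^ (Nat.log 2 m + 1) * (2 : ℤ) ^ (K - 1) :=
    mul_le_mul_of_nonneg_right hm.le (by positivity)
  have h3 : (2 : ℤ) ^ (Nat.log 2 m + 1) * (2 : ℤ) ^ (K - 1) ≤ 2 ^ (K + Nat.log 2 m ^ 2) := by
    rw [← pow_add]
    exact pow_le_pow_right₀ (by norm_num) (by omega)
  have : (n : ℤ) ≤ 2 ^ (K + Nat.log 2 m ^ 2) := h1.trans (h2.trans h3)
  exact_mod_cast this

end TwoSided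

end Summit.ValiantsHypothesis.ValiantsHypothesis.Theorems.KPlusLogSqLaw
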